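import Literature.NumberTheory.EllipticCurves.HeegnerPointsKolyvaginPrimaryCongruenceProofs
import Literature.NumberTheory.EllipticCurves.GaloisActionProofs
import Literature.NumberTheory.EllipticCurves.TorsionStructureProofs
import HarnessLib

/-!
# Route `ByReductionTypeAtTwo`, crux `RankOneAtTwoOffBigImageOddLocal` (stmt-BirchSwinnertonDyer-23716), line
# `refined_kolyvagin_tamagawa_shift_at_two` — ENGINE PORT `c₀ ↦ h₀` (regular element), §E the (3.3) port: complex conjugation ↦ any element inverting `μ`

Lead prover `prover-cruxlead-stmt-BirchSwinnertonDyer-23716-g0` (2026-08-28), landing the crux-plan g6 ENGINE QUARRY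
`Cruxes/RankOneAtTwoOffBigImageOddLocal/RefinedKolyvaginEngineG6.lean` (planner `cruxplan-…-23716-refined-kolyvag-9ff2fe475f-g6`, v4, 1631 lines,
rc 0 / 0 sorry; `Cruxes/` files are not importable, so the lead COPIES the proofs into `Theorems/` — card «LEAD QUICKSTART (g6)» Q2 #3 / Q4) as
`--supports stmt-BirchSwinnertonDyer-23716` helpers.  The engine port is kernel-closable item #3 of the pen's order (PEN-PICK-23716 ADD-4): replace
complex conjugation `c₀` by a REGULAR element `h₀` (det `−1`, trace `0`, odd mod `2`) in the tree's equivariant-Čebotarev engine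
`GenusExact.exists_kolyvaginPrime_gt_two_of_galoisElement`, so that Kolyvagin primes with LOSSLESS local Kummer maps exist on the `Δ > 0` cells of the
S₃-locus (where `ρ̄₂(c₀) = 1` loses the top bit — residual 24883), feeding the line's filtered stubs `…WithOn Φ_reg Ω` (card #7
`regular-frobenius-kolyvagin-primes-pos-disc`).  THIS FILE: §E part 1 — `smul_eq_inv_of_smul_torsion_eq_of_inverts`, `pow_dvd_add_one_of_frob_smul_eq_of_inverts` (`p^M ∣ ℓ + 1`) and `pow_dvd_frobeniusTraceAt_of_frob_smul_eq_of_inverts` (`p^M ∣ a_ℓ`) for a Frobenius acting on `E[p^M]` as an element inverting `μ_{p^M}` (squaring to `1` on the module only), and the Weil-pairing algebra `pairing_*` (`pairing_eq_inv_of_det_eq_neg_one`, `pairing_isPrimitiveRoot_of_span`).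

Statements and proofs are the quarry's VERBATIM (namespace moved to `…Theorems.OffBigImageOddLocalAtTwo.Engine`).  Nothing here proves the crux,
`BSDp W 2`, BSD or the summit; no registered stub is discharged (engine inputs only).  BSD is not proved.

Refs: [GrossLMS1991] §3 (3.1)–(3.3), §9; [McCallumLMS1991] §3; [SilvermanAEC2009] III.§1, III.§8 (Weil pairing), VII–VIII; Dokchitser–Dokchitser (2012);
Serre (1972) §5.3.
-/

set_option linter.dupNamespace false -- tree convention: `Summit.BirchSwinnertonDyer.BirchSwinnertonDyer.Theorems` (summit = sub-problem)
set_option autoImplicit false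

noncomputable section

namespace Summit.BirchSwinnertonDyer.BirchSwinnertonDyer.Theorems.OffBigImageOddLocalAtTwo.Engine

/-! ## §E  The (3.3) port: complex conjugation ↦ any element inverting `μ` (PROVED; card ENGINE-PORT MAP step E0)

The tree's `FrobEqFrobInfty`-consumers use `IsComplexConjugation c₀` only through (i) `c₀` inverts roots of unity
(`RatClosure.smul_eq_inv_of_pow_eq_one`), (ii) `c₀² = 1`, (iii) `c₀|_K = τ`.  For the line's regular element `h₀`
(`det ρ(h₀) = -1`, `ρ_{2^{M+1}}(h₀)² = 1`, `h₀|_K = τ`, but `h₀² ≠ 1` in `Γ_ℚ`) this section re-proves the (3.3)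
consequences from exactly those properties:
`smul_eq_inv_of_smul_torsion_eq_of_inverts` (tree `smul_eq_inv_of_smul_torsion_pow_eq` with (i) as hypothesis),
`pow_dvd_add_one_of_frob_smul_eq_of_inverts` (`p^M ∣ ℓ + 1`), `pow_dvd_frobeniusTraceAt_of_frob_smul_eq_of_inverts`
(`p^M ∣ a_ℓ`, with (ii) as the hypothesis `∀ P, c₀ • c₀ • P = P` on `E[p^M]` only), and the CONVERSE Weil-pairing algebra
supplying (i) from a matrix: `pairing_lin_comb` (`e(aS+cT, bS+dT)·e(S,T)^{bc} = e(S,T)^{ad}`), `pairing_eq_inv_of_det_eq_neg_one`,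
`pairing_isPrimitiveRoot_of_span`, basis glue (`eq_nsmul_add_nsmul_of_basis`, `natCast_val_det_eq_of_det_eq_neg_one`,
`pow_nsmul_basis_ne_zero`, `smul_smul_eq_self_of_basis`) and the capstone `smul_eq_inv_of_det_repr_eq_neg_one`:
**`det (b.repr (σ • b j) i) = -1` for a `ZMod p^{n+1}`-basis `b` of `E[p^{n+1}]` ⟹ `σ • ζ = ζ⁻¹` for every `ζ ∈ μ_{p^{n+1}}`.**
-/

section CyclotomicE

open scoped Classical
open WeierstrassCurve NumberField IsDedekindDomain Field
open Literature.NumberTheory.GaloisRepresentations Literature.NumberTheory.EllipticCurves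

section CyclotomicE0sub

variable (W : WeierstrassCurve ℚ)

/-- **E0 (port of the tree's `smul_eq_inv_of_smul_torsion_pow_eq`, complex conjugation ↦ ANY element inverting `μ_q`).**
An automorphism `h` acting on `E(ℚ̄)[q]`, `q = p^M`, as some `c₀ ∈ Γ_ℚ` that inverts the `q`-th roots of unity, inverts them too
(Weil pairing; the tree proof verbatim with `IsComplexConjugation c₀` replaced by the one property it was used for). -/
theorem smul_eq_inv_of_smul_torsion_eq_of_inverts [W.IsElliptic] {p : ℕ} (hp : p.Prime) {M : ℕ}
    (hM : 1 ≤ M) {q : ℕ} (hq : q = p ^ M) {h c₀ : absoluteGaloisGroup ℚ}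
    (hc₀ : ∀ ζ : AlgebraicClosure ℚ, ζ ^ q = 1 → c₀ • ζ = ζ⁻¹)
    (hhP : ∀ P : geomTorsion W (q : ℤ), h • P = c₀ • P) {ζ : AlgebraicClosure ℚ}
    (hζ : ζ ^ q = 1) : h • ζ = ζ⁻¹ := by
  haveI : Fact p.Prime := ⟨hp⟩
  subst hq
  obtain ⟨n, rfl⟩ : ∃ n, M = n + 1 := ⟨M - 1, by omega⟩
  have hq0 : p ^ (n + 1) ≠ 0 := pow_ne_zero _ hp.ne_zero
  have hq2 : 2 ≤ p ^ (n + 1) :=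
    le_trans hp.two_le (by
      calc p = p ^ 1 := (pow_one p).symm
        _ ≤ p ^ (n + 1) := Nat.pow_le_pow_right hp.pos (by omega))
  obtain ⟨e, hpow, hadd₁, hadd₂, -, hnd, hgal⟩ :=
    W.exists_weilPairing_holds (p ^ (n + 1)) hq2 (by exact_mod_cast hq0)
  -- `h` inverts every value of `e`
  have hval : ∀ S T, h • e S T = (e S T)⁻¹ := fun S T ↦ by
    rw [hgal, hhP, hhP, ← hgal, hc₀ _ (hpow S T)]
  -- `e S (m • T) = (e S T)^m`
  have hne : ∀ S T, e S T ≠ 0 := fun S T h0 ↦ by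
    have := hpow S T
    rw [h0, zero_pow hq0] at this
    exact zero_ne_one this
  have hzero_right : ∀ S, e S 0 = 1 := fun S ↦ by
    have h1 := hadd₂ S 0 0
    rw [add_zero] at h1
    exact (mul_eq_left₀ (hne S 0)).mp h1.symm
  have hnsmul_right : ∀ (m : ℕ) S T, e S (m • T) = e S T ^ m := fun m S T ↦ by
    induction m with
    | zero => rw [zero_nsmul, pow_zero, hzero_right]
    | succ m ih => rw [succ_nsmul, hadd₂, ih, pow_succ]
  -- some `S₀` with `p^n S₀ ≠ 0`
  have hqn0 : p ^ n ≠ 0 := pow_ne_zero n hp.ne_zero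
  haveI : Finite (geomTorsion W ((p ^ (n + 1) : ℕ) : ℤ)) :=
    finite_torsionPoints_holds W (AlgebraicClosure ℚ) (by exact_mod_cast hq0)
  haveI : Finite (geomTorsion W ((p ^ n : ℕ) : ℤ)) :=
    finite_torsionPoints_holds W (AlgebraicClosure ℚ) (by exact_mod_cast hqn0)
  have hc1 : Nat.card (geomTorsion W ((p ^ (n + 1) : ℕ) : ℤ)) = (p ^ (n + 1)) ^ 2 :=
    card_torsionPoints_eq_sq_holds W (AlgebraicClosure ℚ) (by exact_mod_cast hq0)
  have hc2 : Nat.card (geomTorsion W ((p ^ n : ℕ) : ℤ)) = (p ^ n) ^ 2 :=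
    card_torsionPoints_eq_sq_holds W (AlgebraicClosure ℚ) (by exact_mod_cast hqn0)
  obtain ⟨S₀, hS₀⟩ : ∃ S₀ : geomTorsion W ((p ^ (n + 1) : ℕ) : ℤ), p ^ n • S₀ ≠ 0 := by
    by_contra hall
    push Not at hall
    have hle : Nat.card (geomTorsion W ((p ^ (n + 1) : ℕ) : ℤ)) ≤
        Nat.card (geomTorsion W ((p ^ n : ℕ) : ℤ)) :=
      Nat.card_le_card_of_injective
        (fun S ↦ (⟨S.1, (mem_geomTorsion_iff W _ _).mpr (by
          have h1 := congrArg Subtype.val (hall S)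
          rw [AddSubgroupClass.coe_nsmul, ZeroMemClass.coe_zero, ← natCast_zsmul,
            Nat.cast_pow] at h1
          rw [Nat.cast_pow]
          exact h1)⟩ : geomTorsion W ((p ^ n : ℕ) : ℤ)))
        (fun S S' hS ↦ Subtype.ext (by simpa using congrArg Subtype.val hS))
    rw [hc1, hc2] at hle
    have hlt : p ^ n < p ^ (n + 1) := Nat.pow_lt_pow_right hp.one_lt (by omega)
    have := Nat.pow_lt_pow_left hlt two_ne_zero
    omega
  -- some `T₀` with `e T₀ S₀` a primitive `p^{n+1}`-th root of unity
  obtain ⟨T₀, hT₀⟩ : ∃ T₀, e T₀ S₀ ^ p ^ n ≠ 1 := by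
    by_contra hall
    push Not at hall
    exact hS₀ (hnd _ fun S ↦ by rw [hnsmul_right, hall])
  have hord : orderOf (e T₀ S₀) = p ^ (n + 1) := orderOf_eq_prime_pow hT₀ (hpow T₀ S₀)
  have hprim : IsPrimitiveRoot (e T₀ S₀) (p ^ (n + 1)) := hord ▸ IsPrimitiveRoot.orderOf _
  obtain ⟨k, -, hk⟩ := hprim.eq_pow_of_pow_eq_one hζ
  rw [← hk, smul_pow', hval, inv_pow]

/-- **E0 ⇒ (3.3): `p^M ∣ ℓ + 1`** when an arithmetic Frobenius `h` at `𝔓 ∣ ℓ` acts on `E[p^M]` as an element `c₀` inverting `μ_{p^M}`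
(the tree's `pow_dvd_add_one_of_frobEqFrobInfty` with `FrobEqFrobInfty` opened up and complex conjugation replaced by that property —
the regular `h₀` of the line has `det ρ(h₀) = -1`, hence inverts `μ` by `det ρ = χ_cyc`). [cite: GrossLMS1991, §3 (3.3)] [cite: McCallumLMS1991, §4] -/
theorem pow_dvd_add_one_of_frob_smul_eq_of_inverts [W.IsElliptic] {p : ℕ} (hp : p.Prime) {M : ℕ}
    (hM : 1 ≤ M) {ℓ : ℕ} (hℓ : ℓ.Prime) (hℓp : ℓ ≠ p) {v : HeightOneSpectrum (𝓞 ℚ)}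
    {𝔓₀ : Ideal (absIntegers (𝓞 ℚ) ℚ)} {h c₀ : absoluteGaloisGroup ℚ} (hℓv : (ℓ : 𝓞 ℚ) ∈ v.asIdeal)
    (h𝔓₀ : 𝔓₀ ∈ v.primesAbove) (hh : IsArithFrobAt (𝓞 ℚ) h 𝔓₀)
    (hc₀ : ∀ ζ : AlgebraicClosure ℚ, ζ ^ (p ^ M) = 1 → c₀ • ζ = ζ⁻¹)
    (hE : ∀ P : geomTorsion W ((p ^ M : ℕ) : ℤ), h • P = c₀ • P) :
    p ^ M ∣ ℓ + 1 := by
  haveI : Fact p.Prime := ⟨hp⟩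
  -- a primitive `p^M`-th root of unity in `ℚ̄`
  have hq0 : ((p ^ M : ℕ) : AlgebraicClosure ℚ) ≠ 0 := by exact_mod_cast pow_ne_zero M hp.ne_zero
  haveI : NeZero ((p ^ M : ℕ) : AlgebraicClosure ℚ) := ⟨hq0⟩
  obtain ⟨ζ, hζ⟩ := IsAlgClosed.exists_root (Polynomial.cyclotomic (p ^ M) (AlgebraicClosure ℚ))
    (Polynomial.degree_cyclotomic_pos (p ^ M) _ (pos_of_ne_zero (pow_ne_zero M hp.ne_zero))).ne'
  have hprim : IsPrimitiveRoot ζ (p ^ M) := Polynomial.isRoot_cyclotomic_iff.mp hζ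
  -- `h ζ = ζ⁻¹` and `h ζ = ζ ^ N(ℓ) = ζ ^ ℓ`
  have h1 : h • ζ = ζ⁻¹ :=
    smul_eq_inv_of_smul_torsion_eq_of_inverts W hp hM rfl hc₀ hE hprim.pow_eq_one
  have hpv : (p : 𝓞 ℚ) ∉ v.asIdeal := not_natCast_mem_of_prime_ne hℓ hp hℓp v hℓv
  have h2 : h • ζ = ζ ^ v.residueCard :=
    smul_eq_pow_residueCard_of_isArithFrobAt (ℓ := p) hpv h𝔓₀ hh (n := M) hprim.pow_eq_one
  rw [residueCard_eq_of_natCast_mem_rat hℓ hℓv, h1] at h2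
  -- `ζ ^ (ℓ + 1) = 1`
  have hζ0 : ζ ≠ 0 := hprim.ne_zero (pow_ne_zero M hp.ne_zero)
  have hζ1 : ζ ^ (ℓ + 1) = 1 := by
    rw [pow_succ, ← h2, inv_mul_cancel₀ hζ0]
  exact (hprim.pow_eq_one_iff_dvd (ℓ + 1)).mp hζ1

/-- **E0 ⇒ (3.3), trace half: `p^M ∣ a_ℓ`** when an arithmetic Frobenius `h` at a good place `v ∋ ℓ` acts on `E[p^M]` as an element `c₀`
that inverts `μ_{p^M}` and whose SQUARE acts trivially on `E[p^M]` (the tree's `pow_dvd_frobeniusTraceAt_of_frobEqFrobInfty` with complex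
conjugation replaced by these two properties — both held by the line's regular `h₀`: `det ρ(h₀) = -1`, `ρ(h₀)² = 1` although `h₀² ≠ 1` in `Γ_ℚ`).
[cite: GrossLMS1991, §3 (3.3)] [cite: McCallumLMS1991, §4] -/
theorem pow_dvd_frobeniusTraceAt_of_frob_smul_eq_of_inverts [W.IsElliptic] {p : ℕ} (hp : p.Prime)
    {M : ℕ} (hM : 1 ≤ M) {ℓ : ℕ} (hℓ : ℓ.Prime) (hℓp : ℓ ≠ p)
    {v : HeightOneSpectrum (𝓞 ℚ)} (hℓv : (ℓ : 𝓞 ℚ) ∈ v.asIdeal) (hgood : W.HasGoodReductionAt v)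
    {𝔓₀ : Ideal (absIntegers (𝓞 ℚ) ℚ)} {h c₀ : absoluteGaloisGroup ℚ}
    (h𝔓₀ : 𝔓₀ ∈ v.primesAbove) (hh : IsArithFrobAt (𝓞 ℚ) h 𝔓₀)
    (hc₀ : ∀ ζ : AlgebraicClosure ℚ, ζ ^ (p ^ M) = 1 → c₀ • ζ = ζ⁻¹)
    (hc₀sq : ∀ P : geomTorsion W ((p ^ M : ℕ) : ℤ), c₀ • c₀ • P = P)
    (hE : ∀ P : geomTorsion W ((p ^ M : ℕ) : ℤ), h • P = c₀ • P) :
    ((p : ℤ) ^ M) ∣ W.frobeniusTraceAt v := by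
  haveI : Fact p.Prime := ⟨hp⟩
  obtain ⟨n, rfl⟩ : ∃ n, M = n + 1 := ⟨M - 1, by omega⟩
  have hpv : (p : 𝓞 ℚ) ∉ v.asIdeal := not_natCast_mem_of_prime_ne hℓ hp hℓp v hℓv
  have hpQ : (p : ℚ) ≠ 0 := by exact_mod_cast hp.ne_zero
  -- `tr(h | T_p E) = a_ℓ`
  have htr := W.trace_galoisRepTate_frobenius_of_hasGoodReductionAt_holds p v hpv hgood h𝔓₀ hh
  -- `det(h | T_p E) ≡ -1`: `h` inverts `μ_{p^{n+1}}`
  have hinv : ∀ t : AlgebraicClosure ℚ, t ^ p ^ (n + 1) = 1 → h • t = t ^ (p ^ (n + 1) - 1) := by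
    intro t ht
    rw [smul_eq_inv_of_smul_torsion_eq_of_inverts W hp hM rfl hc₀ hE ht]
    have ht0 : t ≠ 0 := fun h0 ↦ by
      rw [h0, zero_pow (pow_ne_zero _ hp.ne_zero)] at ht; exact zero_ne_one ht
    rw [eq_comm, ← mul_left_inj' ht0, inv_mul_cancel₀ ht0, ← pow_succ,
      Nat.sub_add_cancel (Nat.one_le_pow _ _ hp.pos), ht]
  have hdet := toZModPow_det_galoisRepTate_eq W p hpQ n (W.exists_weilPairing_holds _) h
    (p ^ (n + 1) - 1) hinv
  have hcast : ((p ^ (n + 1) - 1 : ℕ) : ZMod (p ^ (n + 1))) = -1 := by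
    rw [Nat.cast_sub (Nat.one_le_pow _ _ hp.pos), ZMod.natCast_self, Nat.cast_one, zero_sub]
  rw [hcast] at hdet
  -- `h² = 1` on `E[p^{n+1}]`
  have hsq : ∀ P : W.geomPoints, P ∈ geomTorsion W ((p ^ (n + 1) : ℕ) : ℤ) → h • h • P = P := by
    intro P hP
    have h1 := congrArg Subtype.val (hE ⟨P, hP⟩)
    have h2 := congrArg Subtype.val (hE (h • ⟨P, hP⟩))
    simp only [AddSubgroup.torsionBy.coe_smul] at h1 h2
    rw [h1] at h2
    rw [h1, h2]
    have h3 := congrArg Subtype.val (hc₀sq ⟨P, hP⟩)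
    simpa only [AddSubgroup.torsionBy.coe_smul] using h3
  have h0 := toZModPow_trace_galoisRepTate_eq_zero W p hpQ n h hsq hdet
  rw [htr, map_intCast, ZMod.intCast_zmod_eq_zero_iff_dvd] at h0
  exact_mod_cast h0

end CyclotomicE0sub

/-! ### E0 (converse direction): a matrix of determinant `-1` in a basis of `E[q]` inverts `μ_q` (Weil pairing algebra) -/

section WeilDet

variable {Tq : Type*} [AddCommGroup Tq] {L : Type*} [Field L] (e : Tq → Tq → L)

omit [AddCommGroup Tq] in
/-- Values of a pairing with `e S T ^ q = 1`, `q ≠ 0`, are nonzero. -/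
theorem pairing_ne_zero {q : ℕ} (hq : q ≠ 0) (hpow : ∀ S T, e S T ^ q = 1) (S T : Tq) : e S T ≠ 0 := by
  intro h0
  have := hpow S T
  rw [h0, zero_pow hq] at this
  exact zero_ne_one this

/-- The pairing is trivial on `0` in the first slot. [folklore] -/
theorem pairing_zero_left {q : ℕ} (hq : q ≠ 0) (hpow : ∀ S T, e S T ^ q = 1)
    (hadd₁ : ∀ S₁ S₂ T, e (S₁ + S₂) T = e S₁ T * e S₂ T) (T : Tq) : e 0 T = 1 := by
  have h1 := hadd₁ 0 0 T
  rw [add_zero] at h1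
  exact (mul_eq_left₀ (pairing_ne_zero e hq hpow 0 T)).mp h1.symm

/-- The pairing is trivial on `0` in the second slot. [folklore] -/
theorem pairing_zero_right {q : ℕ} (hq : q ≠ 0) (hpow : ∀ S T, e S T ^ q = 1)
    (hadd₂ : ∀ S T₁ T₂, e S (T₁ + T₂) = e S T₁ * e S T₂) (S : Tq) : e S 0 = 1 := by
  have h1 := hadd₂ S 0 0
  rw [add_zero] at h1
  exact (mul_eq_left₀ (pairing_ne_zero e hq hpow S 0)).mp h1.symm

/-- Multiplicativity in the first slot: `e (n • S) T = (e S T)^n`. [folklore] -/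
theorem pairing_nsmul_left {q : ℕ} (hq : q ≠ 0) (hpow : ∀ S T, e S T ^ q = 1)
    (hadd₁ : ∀ S₁ S₂ T, e (S₁ + S₂) T = e S₁ T * e S₂ T) (m : ℕ) (S T : Tq) :
    e (m • S) T = e S T ^ m := by
  induction m with
  | zero => rw [zero_nsmul, pow_zero, pairing_zero_left e hq hpow hadd₁]
  | succ m ih => rw [succ_nsmul, hadd₁, ih, pow_succ]

/-- Multiplicativity in the second slot: `e S (n • T) = (e S T)^n`. [folklore] -/
theorem pairing_nsmul_right {q : ℕ} (hq : q ≠ 0) (hpow : ∀ S T, e S T ^ q = 1)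
    (hadd₂ : ∀ S T₁ T₂, e S (T₁ + T₂) = e S T₁ * e S T₂) (m : ℕ) (S T : Tq) :
    e S (m • T) = e S T ^ m := by
  induction m with
  | zero => rw [zero_nsmul, pow_zero, pairing_zero_right e hq hpow hadd₂]
  | succ m ih => rw [succ_nsmul, hadd₂, ih, pow_succ]

/-- Skew-symmetry from alternation: `e T S * e S T = 1`. -/
theorem pairing_swap_mul (hadd₁ : ∀ S₁ S₂ T, e (S₁ + S₂) T = e S₁ T * e S₂ T)
    (hadd₂ : ∀ S T₁ T₂, e S (T₁ + T₂) = e S T₁ * e S T₂) (halt : ∀ T, e T T = 1) (S T : Tq) :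
    e T S * e S T = 1 := by
  have h := halt (S + T)
  rw [hadd₁, hadd₂, hadd₂, halt, halt, one_mul, mul_one, mul_comm] at h
  exact h

/-- **Determinant formula**: `e (aS + cT) (bS + dT) · e(S,T)^{bc} = e(S,T)^{ad}` (i.e. `e(σS, σT) = e(S,T)^{ad-bc}` for the matrix
`[[a,b],[c,d]]` of `σ` in the pair `(S, T)`). -/
theorem pairing_lin_comb {q : ℕ} (hq : q ≠ 0) (hpow : ∀ S T, e S T ^ q = 1)
    (hadd₁ : ∀ S₁ S₂ T, e (S₁ + S₂) T = e S₁ T * e S₂ T)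
    (hadd₂ : ∀ S T₁ T₂, e S (T₁ + T₂) = e S T₁ * e S T₂) (halt : ∀ T, e T T = 1)
    (S T : Tq) (a b c d : ℕ) :
    e (a • S + c • T) (b • S + d • T) * e S T ^ (b * c) = e S T ^ (a * d) := by
  have hsw := pairing_swap_mul e hadd₁ hadd₂ halt S T
  have h1 : e (a • S) (b • S) = 1 := by
    rw [pairing_nsmul_left e hq hpow hadd₁, pairing_nsmul_right e hq hpow hadd₂, halt, one_pow, one_pow]
  have h2 : e (a • S) (d • T) = e S T ^ (a * d) := by
    rw [pairing_nsmul_left e hq hpow hadd₁, pairing_nsmul_right e hq hpow hadd₂, ← pow_mul, Nat.mul_comm d a]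
  have h3 : e (c • T) (b • S) = e T S ^ (b * c) := by
    rw [pairing_nsmul_left e hq hpow hadd₁, pairing_nsmul_right e hq hpow hadd₂, ← pow_mul]
  have h4 : e (c • T) (d • T) = 1 := by
    rw [pairing_nsmul_left e hq hpow hadd₁, pairing_nsmul_right e hq hpow hadd₂, halt, one_pow, one_pow]
  rw [hadd₁, hadd₂, hadd₂, h1, h2, h3, h4, one_mul, mul_one, mul_assoc, ← mul_pow, hsw, one_pow, mul_one]

/-- **`det ≡ -1 (mod q)` ⟹ the pairing value is inverted**: if `S' = aS + cT`, `T' = bS + dT` with `ad + 1 ≡ bc (mod q)`, then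
`e S' T' = (e S T)⁻¹`.  With `S' = σ • S`, `T' = σ • T` and Galois-equivariance `σ • e S T = e (σ • S) (σ • T)` this is
«`det ρ_q(σ) = -1` in the basis `(S,T)` ⟹ `σ` inverts `e(S,T)`». -/
theorem pairing_eq_inv_of_det_eq_neg_one {q : ℕ} (hq : q ≠ 0) (hpow : ∀ S T, e S T ^ q = 1)
    (hadd₁ : ∀ S₁ S₂ T, e (S₁ + S₂) T = e S₁ T * e S₂ T)
    (hadd₂ : ∀ S T₁ T₂, e S (T₁ + T₂) = e S T₁ * e S T₂) (halt : ∀ T, e T T = 1)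
    (S T : Tq) (a b c d : ℕ) (hdet : ((a * d + 1 : ℕ) : ZMod q) = ((b * c : ℕ) : ZMod q))
    {S' T' : Tq} (hS : S' = a • S + c • T) (hT : T' = b • S + d • T) :
    e S' T' = (e S T)⁻¹ := by
  subst hS hT
  have hx0 : e S T ≠ 0 := pairing_ne_zero e hq hpow S T
  have hlin := pairing_lin_comb e hq hpow hadd₁ hadd₂ halt S T a b c d
  -- `x ^ (a*d + 1) = x ^ (b*c)` since the exponents agree mod `q` and `x ^ q = 1`
  have hmod : (a * d + 1) % q = (b * c) % q := (ZMod.natCast_eq_natCast_iff' _ _ _).mp hdet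
  have hpowmod : ∀ n : ℕ, e S T ^ n = e S T ^ (n % q) := fun n ↦ by
    conv_lhs => rw [← Nat.div_add_mod n q, pow_add, pow_mul, hpow S T, one_pow, one_mul]
  have hexp : e S T ^ (a * d) * e S T = e S T ^ (b * c) := by
    rw [← pow_succ, hpowmod (a * d + 1), hmod, ← hpowmod]
  have h3 : e (a • S + c • T) (b • S + d • T) * e S T = 1 := by
    have h2 : e (a • S + c • T) (b • S + d • T) * e S T * e S T ^ (b * c) = 1 * e S T ^ (b * c) := by
      rw [mul_right_comm, hlin, hexp, one_mul]
    exact mul_right_cancel₀ (pow_ne_zero _ hx0) h2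
  exact eq_inv_of_mul_eq_one_left h3

/-- **A pairing value on a spanning pair is a PRIMITIVE `p^{n+1}`-th root of unity** (non-degeneracy): if every point is `iS + jT` and
`p^n T ≠ 0` then `e S T` has exact order `p^{n+1}`. -/
theorem pairing_isPrimitiveRoot_of_span {p n : ℕ} [hp : Fact p.Prime]
    (hpow : ∀ S T, e S T ^ p ^ (n + 1) = 1)
    (hadd₁ : ∀ S₁ S₂ T, e (S₁ + S₂) T = e S₁ T * e S₂ T)
    (hadd₂ : ∀ S T₁ T₂, e S (T₁ + T₂) = e S T₁ * e S T₂) (halt : ∀ T, e T T = 1)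
    (hnd : ∀ T, (∀ S, e S T = 1) → T = 0) (S T : Tq) (hspan : ∀ X : Tq, ∃ i j : ℕ, X = i • S + j • T)
    (hT : p ^ n • T ≠ 0) : IsPrimitiveRoot (e S T) (p ^ (n + 1)) := by
  have hq : p ^ (n + 1) ≠ 0 := pow_ne_zero _ hp.out.ne_zero
  have hnot : ¬ e S T ^ p ^ n = 1 := by
    intro h1
    apply hT
    apply hnd
    intro X
    obtain ⟨i, j, rfl⟩ := hspan X
    rw [hadd₁, pairing_nsmul_left e hq hpow hadd₁, pairing_nsmul_left e hq hpow hadd₁,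
      pairing_nsmul_right e hq hpow hadd₂, pairing_nsmul_right e hq hpow hadd₂, h1, halt, one_pow, one_pow,
      one_pow, one_mul]
  have hord : orderOf (e S T) = p ^ (n + 1) := orderOf_eq_prime_pow hnot (hpow S T)
  exact hord ▸ IsPrimitiveRoot.orderOf _

end WeilDet

end CyclotomicE

end Summit.BirchSwinnertonDyer.BirchSwinnertonDyer.Theorems.OffBigImageOddLocalAtTwo.Engine

end
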